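import Summits.ResolutionOfSingularities.ResolutionOfSingularities.Theorems.PurelyInseparableDim4SwapTransport
import Summits.ResolutionOfSingularities.ResolutionOfSingularities.Theorems.PurelyInseparableDim4ResConeRotationPartner
import HarnessLib
import HarnessLib.Audit.Tags

/-!
# Purely inseparable four-folds — a LOSSY light step transported to the LOSS-FREE side: swap partner ∘ SN3 glued by
# composition of re-presentation relations; bookkeeping of the loss-free virtual step
# (cell `res-dim4-pi`, K2(p) lane, slice C; light-lossy class = hN4-C, kernel seat res-dim4-p-1 g5, FILE 3 of 4)

[OURS · counted 0 · cell `res-dim4-pi` · K2(p) lane (holder res-dim4-p-12 g4; route of record «LIGHT-LOSSY = C13 ∘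
RE-PRESENTATION (hN4-C)», res-dim4-idea-1 g7; holder's note 06:32:53Z «a light LOSSY step is the SAME infinitely-near point as
the LOSS-FREE step in the chart of the translated letter») · seat res-dim4-p-1 g5.]  Nothing here proves K2(5)
(`RidgeBudget.NoAboveFloorTrap 5 5`), `NoIsolatedTrap 5 5` or resolution of singularities in dimension ≥ 4 / characteristic
`p` — NOT proved.  AI kernel work, weaker than expert review.

Setting: a one-free-letter unit-class relation `ℛ_π(A.F, B.F)` (res-dim4-p-7 g3 `…SwapRelation`; `B`'s free letter `φ`,
`A`'s free letter `π φ`) at precision `M ≥ p + 1`, both states of order `≥ p`.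
* §1 **`rel_lossy_step`** — the REAL chain takes the LOSSY step at `A` (chart = the free letter `π φ`, the boundary letter
  `π a` translated by `τ′ ≠ 0`); the VIRTUAL chain takes the LOSS-FREE step at `B` (chart `a`, the free letter `φ` translated
  by `γ′`) where `γ′` solves res-dim4-p-11 g3's 1-jet relation for the loss-free PARTNER step of `A` (chart `π a`, `π φ`
  translated by `τ = 1/τ′`).  Then the children are related by a one-free-letter unit-class relation along
  `π.trans (swap (π a) (π φ))` at precision `M − p`: res-dim4-p-1 g4's `ResCone.rotation_partner_rel` (real child → partner,
  diagonal along the swap, every precision) composed by `SwapNorm.rel_comp` with `SwapTransport.unitFrame_step` (partner →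
  virtual child).  The loss-free case is `SwapTransport.unitFrame_step` itself.
* §2 bookkeeping of the virtual step `step p univ ℓ (γ′·e_φ) B` on a light state (`B.r = 𝟙 − e_φ`, `ord_univ B.F = p + 1`):
  `step_r_apply_of_light` (the boundary is unchanged), `r_eq_mapDomain_of_light` (the `B.r = A.r ∘ π` clause of the readers),
  `witnessed_step_of_ordZero` / `step0_of_ordZero` (the step is a witnessed `Step0 p` step as soon as the child has order `≥ p`).
[cite: Hauser2010, §§F–G] [cite: CossartJannsenSaito2020, Thm. 3.14] [cite: HauserPerlega2019PRIMS, §2 (transform D′ of D)]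
bears_on: LADDER-RESOLUTION:D157-DOOR2 (res-dim4-pi · K2(p) · slice C · light-lossy (5,3) = hN4-C · FILE 3).  Supports
stmt-ResolutionOfSingularities-16155 (helper).
-/

set_option linter.dupNamespace false -- mandated namespace of this single-conjunct summit

noncomputable section

namespace Summit.ResolutionOfSingularities.ResolutionOfSingularities.Theorems.PIDim4

namespace ResCone

namespace LightRep

open MvPolynomial Finset
open Literature.AlgebraicGeometry.Resolution
open Literature.AlgebraicGeometry.Resolution.CentreBlowup
open Literature.AlgebraicGeometry.Resolution.Hauser2010

variable {K : Type} [Field K]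

/-! ## 1. The lossy step, transported -/

section Lossy

variable (p : ℕ) [hp : Fact p.Prime] [CharP K p] [DecidableEq K]

/-- **LOSSY STEP THROUGH THE RELATION** (module docstring §1): the real lossy child `step_{πφ}(τ′·e_{πa}) A` and the virtual
loss-free child `step_a(γ′·e_φ) B` are related by a one-free-letter unit-class relation along `π.trans (swap (π a) (π φ))` (free
letter still `φ`; `A`'s new free letter is `π a`) at precision `M − p`, provided `γ′` solves the 1-jet relation of the partner
step (`τ·e_a(0) = ∂_a G(0) + γ′·e_φ(0)`, `τ τ′ = 1`). [OURS] [cite: Hauser2010, §§F–G] [cite: CossartJannsenSaito2020, Thm. 3.14] -/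
theorem rel_lossy_step (π : Equiv.Perm (Fin 4)) (φ : Fin 4) {M : ℕ} {A B : State K}
    {θ e : Fin 4 → MvPolynomial (Fin 4) K} {G U E : MvPolynomial (Fin 4) K}
    (hθi : ∀ i, i ≠ φ → θ (π i) = X i * e i) (hθf : θ (π φ) = X φ * e φ + G)
    (he : ∀ i, constantCoeff (e i) ≠ 0) (hG0 : constantCoeff G = 0) (hG1 : coeff (Finsupp.single φ 1) G = 0)
    (hU : constantCoeff U ≠ 0) (hE : E ∈ originIdeal K ^ M) (hrel : B.F = deletePthPowers p (U ^ p * aeval θ A.F) + E)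
    (hA : (p : ℕ∞) ≤ ordAlong Finset.univ A.F) (hB : (p : ℕ∞) ≤ ordAlong Finset.univ B.F)
    {a : Fin 4} (haφ : a ≠ φ) {τ τ' γ' : K} (hττ' : τ * τ' = 1)
    (hγ : τ * constantCoeff (e a) = coeff (Finsupp.single a 1) G + γ' * constantCoeff (e φ)) (hM : p + 1 ≤ M) :
    ∃ (θ' e' : Fin 4 → MvPolynomial (Fin 4) K) (G' U' E' : MvPolynomial (Fin 4) K),
      (∀ i, i ≠ φ → θ' ((π.trans (Equiv.swap (π a) (π φ))) i) = X i * e' i) ∧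
      θ' ((π.trans (Equiv.swap (π a) (π φ))) φ) = X φ * e' φ + G' ∧ (∀ i, constantCoeff (e' i) ≠ 0) ∧
      constantCoeff G' = 0 ∧ coeff (Finsupp.single φ 1) G' = 0 ∧ constantCoeff U' ≠ 0 ∧
      E' ∈ originIdeal K ^ (M - p) ∧
      (CentreBlowup.step p Finset.univ a (Pi.single φ γ' : Fin 4 → K) B).F =
        deletePthPowers p (U' ^ p *
          aeval θ' (CentreBlowup.step p Finset.univ (π φ) (Pi.single (π a) τ' : Fin 4 → K) A).F) + E' := by
  have hπaφ : π a ≠ π φ := fun h => haφ (π.injective h)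
  have hτ : τ ≠ 0 := fun h0 => by rw [h0, zero_mul] at hττ'; exact zero_ne_one hττ'
  -- (1) the loss-free partner step transported through `θ` (SN3)
  obtain ⟨θ₂, e₂, G₂, U₂, E₂, h2i, h2f, he₂, hG₂0, hG₂1, hU₂, hE₂, hrel₂⟩ :=
    SwapTransport.unitFrame_step p π φ hθi hθf he hG0 hG1 hU hE hrel hA hB haφ hγ
  -- (2) the swap partner of the lossy child (diagonal, at the target precision)
  obtain ⟨θ₁, e₁, E₁, h1, he₁, -, hE₁, hrel₁, -⟩ := rotation_partner_rel p hA hπaφ hττ' (M := M - p) (by omega)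
  -- (3) compose
  have hU₁ : constantCoeff (X (π φ) + C τ : MvPolynomial (Fin 4) K) ≠ 0 := by
    rw [map_add, constantCoeff_X, constantCoeff_C, zero_add]; exact hτ
  obtain ⟨θ', e', G', U', E', h'i, h'f, he', hG'0, hG'1, hU', hE', hrel'⟩ :=
    SwapNorm.rel_comp p (π := π) (ρ := Equiv.swap (π a) (π φ)) (f := φ) (G₁ := 0)
      (fun k _ => h1 k) (by rw [h1, add_zero]) he₁ (map_zero _) (coeff_zero _) hU₁ hE₁ hrel₁
      h2i h2f he₂ hG₂0 hG₂1 hU₂ hE₂ hrel₂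
  refine ⟨θ', e', G', U', E', h'i, h'f, he', hG'0, hG'1, hU', ?_, hrel'⟩
  rwa [min_self] at hE'

end Lossy

/-! ## 2. Bookkeeping of the virtual (loss-free) step on a light state -/

section Book

variable [DecidableEq K]

/-- The virtual step charts a boundary letter `ℓ ≠ φ` and translates only the free letter `φ`: on a light state
(`B.r = 𝟙 − e_φ`) of order `p + 1` along the point, the boundary is UNCHANGED. [cite: Hauser2010, §F (transform D′)] [folklore] -/
theorem step_r_apply_of_light (p : ℕ) {B : State K} {φ ℓ : Fin 4} (hℓφ : ℓ ≠ φ)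
    (hrB : ∀ i, B.r i = if i = φ then 0 else 1) (hoB : ordAlong Finset.univ B.F = ((p + 1 : ℕ) : ℕ∞)) (γ' : K)
    (i : Fin 4) :
    (CentreBlowup.step p Finset.univ ℓ (Pi.single φ γ' : Fin 4 → K) B).r i = if i = φ then 0 else 1 := by
  rw [SwapNorm.step_r_apply, hoB, ENat.toNat_coe, Nat.add_sub_cancel_left]
  by_cases hiℓ : i = ℓ
  · subst hiℓ; rw [if_pos rfl, if_neg hℓφ]
  · rw [if_neg hiℓ]
    by_cases hiφ : i = φ
    · subst hiφ
      rw [if_pos rfl, hrB, if_pos rfl]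
      split_ifs <;> rfl
    · rw [Pi.single_eq_of_ne hiφ, if_pos rfl, hrB]

omit [DecidableEq K] in
/-- The `B.r = A.r ∘ π` clause of the readers (`…UnitClassCone`, FILE 2) for light boundaries with free letters `φ ↔ π φ`.
[folklore] -/
theorem r_eq_mapDomain_of_light {A B : State K} {π : Equiv.Perm (Fin 4)} {φ : Fin 4}
    (hrB : ∀ i, B.r i = if i = φ then 0 else 1) (hrA : ∀ k, A.r k = if k = π φ then 0 else 1) :
    B.r = A.r.mapDomain π.symm := by
  ext i
  have h := Finsupp.mapDomain_apply π.symm.injective A.r (π i)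
  rw [π.symm_apply_apply] at h
  rw [h, hrB, hrA]
  by_cases hiφ : i = φ
  · rw [if_pos hiφ, if_pos (congrArg π hiφ)]
  · rw [if_neg hiφ, if_neg (fun h' => hiφ (π.injective h'))]

omit [DecidableEq K] in
/-- The light boundary in the `∀ i, r i ≤ 1 ∧ |r| = 3` dress. [folklore] -/
theorem light_of_r_apply {r : Fin 4 →₀ ℕ} {φ : Fin 4} (hr : ∀ i, r i = if i = φ then 0 else 1) :
    (∀ i, r i ≤ 1) ∧ r.degree = 3 := by
  classical
  refine ⟨fun i => by rw [hr]; split_ifs <;> omega, ?_⟩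
  rw [Finsupp.degree_eq_sum, ← Finset.sum_erase_add _ _ (Finset.mem_univ φ), hr φ, if_pos rfl, add_zero,
    Finset.sum_congr rfl (fun i hi => by rw [hr i, if_neg (Finset.ne_of_mem_erase hi)]), Finset.sum_const, smul_eq_mul,
    mul_one, Finset.card_erase_of_mem (Finset.mem_univ _), Finset.card_univ, Fintype.card_fin]

/-- **The virtual step is a witnessed step** as soon as its child has order `≥ p` (then the point is equimultiple —
`Equimultiple.isEquimultiplePoint_iff_le_ordZero_step` — and the child is non-zero). [cite: Hauser2010, §F (equiconstant points)]
[folklore] -/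
theorem witnessed_step_of_ordZero (p : ℕ) {B : State K} (hB : (p : ℕ∞) ≤ ordAlong Finset.univ B.F) {ℓ φ : Fin 4}
    (hℓφ : ℓ ≠ φ) (γ' : K) {o : ℕ}
    (ho : ordZero (CentreBlowup.step p Finset.univ ℓ (Pi.single φ γ' : Fin 4 → K) B).F = o) (hpo : p ≤ o) :
    (p : ℕ∞) ≤ ordAlong Finset.univ B.F ∧ (Pi.single φ γ' : Fin 4 → K) ℓ = 0 ∧
      IsEquimultiplePoint p Finset.univ ℓ (Pi.single φ γ' : Fin 4 → K) B ∧
      (CentreBlowup.step p Finset.univ ℓ (Pi.single φ γ' : Fin 4 → K) B).F ≠ 0 := by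
  refine ⟨hB, Pi.single_eq_of_ne hℓφ _, ?_, ?_⟩
  · rw [Equimultiple.isEquimultiplePoint_iff_le_ordZero_step, ho]
    exact_mod_cast hpo
  · intro h0
    rw [h0, ordZero_zero] at ho
    exact ENat.top_ne_coe o ho

/-- The same, in the `Step0 p` dress. [folklore] -/
theorem step0_of_ordZero (p : ℕ) {B : State K} (hB : (p : ℕ∞) ≤ ordAlong Finset.univ B.F) {ℓ φ : Fin 4}
    (hℓφ : ℓ ≠ φ) (γ' : K) {o : ℕ}
    (ho : ordZero (CentreBlowup.step p Finset.univ ℓ (Pi.single φ γ' : Fin 4 → K) B).F = o) (hpo : p ≤ o) :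
    Step0 p B (CentreBlowup.step p Finset.univ ℓ (Pi.single φ γ' : Fin 4 → K) B) := by
  obtain ⟨hB', hbℓ, heq, hne⟩ := witnessed_step_of_ordZero p hB hℓφ γ' ho hpo
  exact ⟨hB', ℓ, Pi.single φ γ', Finset.mem_univ _, hbℓ, heq, hne, rfl⟩

end Book

end LightRep

end ResCone

end Summit.ResolutionOfSingularities.ResolutionOfSingularities.Theorems.PIDim4

end
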